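import Literature.NumberTheory.EllipticCurves.NewformGaloisRepThm61OfNewformProofs
import Literature.NumberTheory.GaloisRepresentations.LAdicRepFrobenius
import Literature.NumberTheory.GaloisRepresentations.FramedRepEquivConj
import Literature.RepresentationTheory.Semisimple.SubrepresentationEquiv
import HarnessLib

/-!
# A semisimple Galois representation carrying the eigenvalue packet of an eigenform is the
# representation of a newform (Atkin–Lehner–Li + Deligne at every `p`-adic embedding +
# Chebotarev–Brauer–Nesbitt; proofs only)

Topic `Literature/NumberTheory/EllipticCurves`, next to `NewformGaloisRep` (the predicate
`IsGaloisRepOfNewform1 f ι S ρ`: "`ρ` is attached to the cusp form `f` away from `S` through the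
coefficient map `ι`"), `NewformsEigenpacketProofs` (Atkin–Lehner–Li: the packet of an eigenform is
the packet of a newform of level dividing the level, PROVED) and `NewformGaloisRepThm61OfNewformProofs`
(the five equivalent shapes of Deligne's theorem in the tree).  A theorems-only leaf (no definition,
no named fact; D-0026).

The classical dictionary step "**`ρ` arises from a cuspidal eigenform `⟹` `ρ` is, away from
`N p`, THE Galois representation of a newform of level `N`**" — the step by which every
modularity / classicality theorem stated for eigenforms (e.g. Pan, arXiv:2209.06366, Thm. 1.1.2:
"`ρ` arises from a cuspidal eigenform of weight `k + 1`", §7.2.1: "equivalent with saying that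
`M_{k+1}(K^p) ⊗_{ℚ_p} E[λ'] ≠ 0`" for the eigensystem `λ'` with `ρ_{λ'} ≅ ρ`) is read in the
tree's newform vocabulary (`∃ N f ι_f, IsNewform1 f ∧ IsGaloisRepOfNewform1 f ι_f {q ∣ N p} ρ`, the
conclusion shape of `XZhang2024_fontaineMazurGL2_tateTwist`,
`Pan2022_proModularDeRhamClassical_GL2Q`, `Tung2020_fontaineMazurGL2_two_tateTwist`, …) — is
assembled here from results that are all in the tree:

* `IsGaloisRepOfNewform1.of_equiv` — being attached to `f` through `ι` away from `S` is an
  invariant of the isomorphism class of the underlying continuous representation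
  (`FramedGaloisRep.isUnramifiedAt_of_equiv`, `hasFrobCharpolyAt_of_equiv` of
  `FramedRepEquivConj`; Serre 1968, Ch. I §2.3).
* `IsGaloisRepOfNewform1.of_hasFrobCharpolyAt_eventually` — **upgrade "almost everywhere" to
  "everywhere off `S`"**: over a Hausdorff topological field of characteristic `0`, a continuous
  SEMISIMPLE `ρ` whose Frobenius characteristic polynomials are `ι`(Hecke polynomial of `f`) at
  all but finitely many places, granted ONE semisimple `ρ_f` attached to `f` through `ι` away from
  a finite `S`, is itself attached to `f` through `ι` away from `S`, and `ρ ≅ ρ_f`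
  (Deligne–Serre 1974, Lemme 3.2: Chebotarev + Brauer–Nesbitt, the tree's PROVED
  `FramedGaloisRep.nonempty_equiv_of_hasFrobCharpolyAt_eventually` with
  `Automorphic.chebotarev_artinRep_holds`).
* `exists_isNewform1_isGaloisRepOfNewform1_of_eigenform` — **the dictionary step itself** over
  `ℚ̄_ℓ`: let `g ∈ S_k(Γ₁(M))`, `g ≠ 0`, `k ≥ 2`, lie in `S_k(M, χ)` with `T_q g = a_q g` for the
  primes `q ∤ M`, let `ι : ℚ̄_ℓ ≃ ℂ`, and let `ρ : Γ_ℚ → GL₂(ℚ̄_ℓ)` be continuous semisimple with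
  `charpoly ρ(Frob_q) = X² - ι⁻¹(a_q) X + ι⁻¹(χ(q) q^{k-1})` (arithmetic Frobenius) at all but
  finitely many `q`.  Then there is a newform `g₀ ∈ S_k(Γ₁(M₀))`, `M₀ ∣ M`, with `a_q(g₀) = a_q`
  (`q ∤ M`) and nebentypus inducing `χ`, such that `ρ` is attached to `g₀` through
  `ι⁻¹ ∘ (K_{g₀} ⊆ ℂ)` away from `M₀ ℓ` (`IsGaloisRepOfNewform1 g₀ _ {q ∣ M₀ ℓ} ρ`), and `ρ` is
  irreducible.  GRANTED, as the hypothesis `hH`, the tree's named fact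
  `Hida2000_thm326_exists_galoisRep` (Hida 2000, Thm. 3.26 (1) = Deligne's theorem for newforms at
  EVERY `p`-adic embedding of the coefficient field; equivalent to Deligne–Serre 1974, Thm. 6.1 at
  every finite place, `thm61_exists_adicGaloisRep_iff_Hida2000_thm326`).  Proof: Atkin–Lehner–Li
  (`exists_isNewform1_of_eigenpacket`; Diamond–Shurman Thms. 5.8.2–5.8.3) gives `g₀`; Hida's fact at
  `(g₀, ℓ, ι)` gives an irreducible `r` attached to `g₀` away from `M₀ ℓ`, whose Frobenius
  polynomial at `q ∤ M ℓ` is `X² - ι⁻¹(a_q) X + ι⁻¹(χ(q) q^{k-1})` (`map_heckePolynomial`, as in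
  `DeligneSerre1974.deligne_padicAlgCl_of_Hida2000_thm326`); the previous item transports `r`'s
  properties to `ρ`, and irreducibility is an invariant of the isomorphism class
  (`Literature.RepresentationTheory.Semisimple.Representation.isIrreducible_of_equiv`).

Why the every-embedding form of Deligne's theorem: the embedding `K_{g₀} → ℚ̄_ℓ` against which `ρ`
is matched is FORCED by `ρ` (its Frobenius traces), i.e. `ρ` singles out one place `λ ∣ ℓ` of
`K_{g₀}`; the tree's `exists_padicGaloisRep_of_isNewform1` / `Ribet1977.thm21_exists_galoisRep`
(Deligne's representation over ONE completion of `K_{g₀}`) would not suffice, exactly as recorded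
in the docstring of `NewformGaloisRepPadicAlgClProofs`.

## References

* P. Deligne, J.-P. Serre, *Formes modulaires de poids 1*, Ann. Sci. ÉNS (4) 7 (1974), Lemme 3.2
  (p. 513), Thm. 6.1 (p. 521). [DeligneSerreASENS1974]
* F. Diamond, J. Shurman, *A First Course in Modular Forms*, GTM 228 (2005), Thms. 5.8.2–5.8.3
  (PDF pp. 216–219), Thm. 9.6.5 (PDF p. 435). [DiamondShurman2005]
* H. Hida, *Modular Forms and Galois Cohomology* (2000), Thm. 3.26 (1), pp. 151–152. [Hida2000]
* J.-P. Serre, *Abelian ℓ-adic representations and elliptic curves* (1968), Ch. I §2.3.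
  [SerreAbelianLadic1968]
* L. Pan, *On locally analytic vectors of the completed cohomology of modular curves II*,
  arXiv:2209.06366 (2022), Thm. 1.1.2 and §7.2.1 (p. 117) (a consumer of the dictionary step).
  [Pan2022LocallyAnalyticII]
-/

noncomputable section

open scoped MatrixGroups ModularForm NumberField

open CongruenceSubgroup UpperHalfPlane Polynomial IsDedekindDomain
  Rat.HeightOneSpectrum Literature.NumberTheory.GaloisRepresentations

namespace Literature.NumberTheory.EllipticCurves.ModularForms

variable {N : ℕ} [NeZero N] {k : ℤ} {f : CuspForm (Gamma1 N) k}

/-! ### Transport along isomorphisms -/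

section Transport

variable {A : Type*} [CommRing A] [TopologicalSpace A] [IsTopologicalRing A]

/-- **"Attached to `f` through `ι` away from `S`" is an invariant of the isomorphism class**: if
the continuous representations on `A²` underlying `ρ, ρ'` are isomorphic and `ρ` is attached to
`f` through `ι` away from `S` (`IsGaloisRepOfNewform1`), so is `ρ'` — unramifiedness at a place
and the characteristic polynomial of Frobenius there are invariants of the isomorphism class
(`FramedGaloisRep.isUnramifiedAt_of_equiv`, `FramedGaloisRep.hasFrobCharpolyAt_of_equiv`).
[cite: SerreAbelianLadic1968, Ch. I §2.3] -/
theorem IsGaloisRepOfNewform1.of_equiv {ι : coeffCharField f →+* A} {S : Set ℕ}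
    {ρ ρ' : FramedGaloisRep ℚ A 2} (e : ContinuousRep.Equiv ρ.toGaloisRep ρ'.toGaloisRep)
    (h : IsGaloisRepOfNewform1 f ι S ρ) : IsGaloisRepOfNewform1 f ι S ρ' :=
  fun v hv ↦ ⟨FramedGaloisRep.isUnramifiedAt_of_equiv e (h v hv).1,
    FramedGaloisRep.hasFrobCharpolyAt_of_equiv e (h v hv).2⟩

end Transport

/-! ### "Almost everywhere" to "everywhere off `S`" (Chebotarev + Brauer–Nesbitt) -/

section Eventually

variable {A : Type*} [Field A] [TopologicalSpace A] [IsTopologicalRing A] [T2Space A] [CharZero A]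

/-- **A semisimple representation with the Frobenius polynomials of `f` almost everywhere is
attached to `f` wherever some representation of `f` is** (Deligne–Serre 1974, Lemme 3.2:
"Cela résulte du théorème de densité de Čebotarev, combiné avec le fait qu'une représentation
linéaire semi-simple d'un groupe est déterminée, à isomorphisme près, par les polynômes
caractéristiques").  Over a Hausdorff topological field `A` of characteristic `0`: let
`ρ_f : Γ_ℚ → GL₂(A)` be continuous, semisimple and attached to `f` through `ι : K_f → A` away from
`S ⊆ ℕ`, where only finitely many primes lie in `S`; let `ρ : Γ_ℚ → GL₂(A)` be continuous and
semisimple with, at all but finitely many places `v`, `ρ` unramified and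
`charpoly ρ(Frob_v) = ι(X² - a_v(f) X + ε_f(v) v^{k-1})`.  Then `ρ` is attached to `f` through
`ι` away from `S`, and `ρ_f ≅ ρ`.  Proof: off the finite union of the exceptional places and
those over `S`, both are unramified with the same Frobenius polynomial, so
`FramedGaloisRep.nonempty_equiv_of_hasFrobCharpolyAt_eventually` (Chebotarev, PROVED as
`Automorphic.chebotarev_artinRep_holds`, and Brauer–Nesbitt) gives `ρ_f ≅ ρ`; conclude by
`IsGaloisRepOfNewform1.of_equiv`. [cite: DeligneSerreASENS1974, Lemme 3.2 (p. 513)] -/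
theorem IsGaloisRepOfNewform1.of_hasFrobCharpolyAt_eventually {ι : coeffCharField f →+* A}
    {S : Set ℕ} (hS : {v : HeightOneSpectrum (𝓞 ℚ) | ((primesEquiv v : Nat.Primes) : ℕ) ∈ S}.Finite)
    {ρf : FramedGaloisRep ℚ A 2} (hρf : ρf.toGaloisRep.IsSemisimple)
    (hf : IsGaloisRepOfNewform1 f ι S ρf)
    {ρ : FramedGaloisRep ℚ A 2} (hρ : ρ.toGaloisRep.IsSemisimple)
    (h : ∀ᶠ v : HeightOneSpectrum (𝓞 ℚ) in Filter.cofinite,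
      ρ.IsUnramifiedAt v ∧
        ρ.HasFrobCharpolyAt v ((heckePolynomial f (primesEquiv v : Nat.Primes)).map ι)) :
    IsGaloisRepOfNewform1 f ι S ρ ∧
      Nonempty (ContinuousRep.Equiv ρf.toGaloisRep ρ.toGaloisRep) := by
  have hev : ∀ᶠ v : HeightOneSpectrum (𝓞 ℚ) in Filter.cofinite,
      ρf.IsUnramifiedAt v ∧ ρ.IsUnramifiedAt v ∧
        ∃ P : Polynomial A, ρf.HasFrobCharpolyAt v P ∧ ρ.HasFrobCharpolyAt v P := by
    filter_upwards [h, hS.eventually_cofinite_notMem] with v hv hvS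
    exact ⟨(hf v hvS).1, hv.1, _, (hf v hvS).2, hv.2⟩
  obtain ⟨e⟩ := FramedGaloisRep.nonempty_equiv_of_hasFrobCharpolyAt_eventually
    Automorphic.chebotarev_artinRep_holds ρf ρ hρf hρ hev
  exact ⟨hf.of_equiv e, ⟨e⟩⟩

end Eventually

/-! ### The dictionary step: eigenform ⟹ newform, for Galois representations over `ℚ̄_ℓ` -/

section Eigenform

/-- **A semisimple `ℓ`-adic Galois representation carrying the eigenvalue packet of a cuspidal
eigenform is the Galois representation of a newform of level dividing the level** (granted
Deligne's theorem at every `p`-adic embedding, the named fact `Hida2000_thm326_exists_galoisRep`).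
Let `g ∈ S_k(Γ₁(M))`, `g ≠ 0`, `k ≥ 2`, with `g ∈ S_k(M, χ)` and `T_q g = a_q g` for every prime
`q ∤ M`; let `ℓ` be a prime, `ι : ℚ̄_ℓ ≃ ℂ` a field isomorphism, and `ρ : Γ_ℚ → GL₂(ℚ̄_ℓ)`
continuous and SEMISIMPLE such that, at all but finitely many places, `ρ` is unramified with
`charpoly ρ(Frob_q) = X² - ι⁻¹(a_q) X + ι⁻¹(χ(q) q^{k-1})` (arithmetic Frobenius).  Then there are
`M₀ ∣ M` and a newform `g₀ ∈ S_k(Γ₁(M₀))` with `a_q(g₀) = a_q` for the primes `q ∤ M` and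
nebentypus inducing `χ` (Atkin–Lehner–Li, `exists_isNewform1_of_eigenpacket`: Diamond–Shurman
Thms. 5.8.2–5.8.3), such that `ρ` is attached to `g₀` through `ι⁻¹ ∘ (K_{g₀} ⊆ ℂ)` away from
`M₀ ℓ` — unramified at EVERY `q ∤ M₀ ℓ` with `charpoly ρ(Frob_q) = ι⁻¹(X² - a_q(g₀) X +
ε_{g₀}(q) q^{k-1})` — and `ρ` is irreducible: Hida's fact at `(g₀, ℓ, ι)` (Hida 2000, Thm. 3.26
(1): "there exists a continuous absolutely irreducible Galois representation `ρ_{λ'}` … such that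
`Tr ρ(Frob_ℓ) = λ'(T(ℓ))` and `det ρ(Frob_ℓ) = χ(ℓ)ℓ^{k-1}` for all primes `ℓ` outside `pN`")
provides an irreducible `r` attached to `g₀` away from `M₀ ℓ`, whose Frobenius polynomial at
`q ∤ M ℓ` is `X² - ι⁻¹(a_q) X + ι⁻¹(χ(q) q^{k-1})` (`map_heckePolynomial`,
`DirichletCharacter.changeLevel_eq_cast_of_dvd'`); by
`IsGaloisRepOfNewform1.of_hasFrobCharpolyAt_eventually` (Chebotarev + Brauer–Nesbitt) `r ≅ ρ` and
`ρ` inherits `r`'s properties, irreducibility included (`Literature.RepresentationTheory.Semisimple.Representation.isIrreducible_of_equiv`).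
This is the step "`ρ` arises from a cuspidal eigenform `⟹` `ρ` is the representation of a
newform" of every classicality theorem stated for eigenforms (e.g. Pan, arXiv:2209.06366,
Thm. 1.1.2 with §7.2.1).
[cite: DiamondShurman2005, Thms. 5.8.2–5.8.3 (PDF pp. 216–219)] [cite: Hida2000, Thm. 3.26 (1), pp. 151–152]
[cite: DeligneSerreASENS1974, Lemme 3.2 (p. 513)] -/
theorem exists_isNewform1_isGaloisRepOfNewform1_of_eigenform
    (hH : Hida2000_thm326_exists_galoisRep)
    {M : ℕ} [NeZero M] {k : ℤ} (hk : 2 ≤ k) {g : CuspForm (Gamma1 M) k}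
    {χ : DirichletCharacter ℂ M} (hgχ : g ∈ nebentypusSubspace M k χ) (hg0 : g ≠ 0) {a : ℕ → ℂ}
    (hT : ∀ (p : ℕ) (hp : p.Prime), ¬ p ∣ M →
      (haveI : NeZero p := ⟨hp.ne_zero⟩; heckeT (Gamma1 M) k p g) = a p • g)
    {ℓ : ℕ} [Fact ℓ.Prime] (ι : PadicAlgCl ℓ ≃+* ℂ)
    {ρ : FramedGaloisRep ℚ (PadicAlgCl ℓ) 2} (hρ : ρ.toGaloisRep.IsSemisimple)
    (hc : ∀ᶠ w : HeightOneSpectrum (𝓞 ℚ) in Filter.cofinite,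
      ρ.IsUnramifiedAt w ∧
        ρ.HasFrobCharpolyAt w
          (X ^ 2 - C (ι.symm (a ((primesEquiv w : Nat.Primes) : ℕ))) * X +
            C (ι.symm (χ ((primesEquiv w : Nat.Primes) : ℕ) *
              (((primesEquiv w : Nat.Primes) : ℕ) : ℂ) ^ (k - 1))))) :
    ∃ (M₀ : ℕ) (_ : NeZero M₀) (hM₀ : M₀ ∣ M) (g₀ : CuspForm (Gamma1 M₀) k), IsNewform1 g₀ ∧
      (∀ p : ℕ, p.Prime → ¬ p ∣ M → cuspCoeff g₀ p = a p) ∧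
      DirichletCharacter.changeLevel hM₀ (nebentypus g₀) = χ ∧
      IsGaloisRepOfNewform1 g₀
        ((ι.symm : ℂ →+* PadicAlgCl ℓ).comp (algebraMap (coeffCharField g₀) ℂ))
        {q | q ∣ M₀ * ℓ} ρ ∧
      ρ.toGaloisRep.IsIrreducible := by
  classical
  have hℓ : ℓ.Prime := Fact.out
  -- Step 1 (Atkin–Lehner–Li): the packet of `g` is the packet of a newform `g₀` of level `M₀ ∣ M`
  obtain ⟨M₀, _, hM₀, g₀, hg₀, hcoeff, hχ₀⟩ :=
    exists_isNewform1_of_eigenpacket hg0 hgχ (a := a) hT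
  -- Step 2 (Deligne at the embedding `ι⁻¹ ∘ (K_{g₀} ⊆ ℂ)`, Hida's Thm. 3.26 (1)): an irreducible `r`
  obtain ⟨r, hr, hirr⟩ := hH g₀ hk hg₀ ℓ ι
  have hrss : r.toGaloisRep.IsSemisimple := by
    haveI : r.toGaloisRep.toRepresentation.IsIrreducible := hirr
    change r.toGaloisRep.toRepresentation.IsSemisimpleRepresentation
    infer_instance
  set κ : coeffCharField g₀ →+* PadicAlgCl ℓ :=
    (ι.symm : ℂ →+* PadicAlgCl ℓ).comp (algebraMap (coeffCharField g₀) ℂ) with hκ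
  -- Step 3: at `q ∤ M` the hypothesis polynomial IS `κ`(Hecke polynomial of `g₀`)
  have hpoly : ∀ w : HeightOneSpectrum (𝓞 ℚ), ¬ ((primesEquiv w : Nat.Primes) : ℕ) ∣ M →
      (heckePolynomial g₀ (primesEquiv w : Nat.Primes)).map κ =
        X ^ 2 - C (ι.symm (a ((primesEquiv w : Nat.Primes) : ℕ))) * X +
          C (ι.symm (χ ((primesEquiv w : Nat.Primes) : ℕ) *
            (((primesEquiv w : Nat.Primes) : ℕ) : ℂ) ^ (k - 1))) := by
    intro w hwM
    rw [hκ, ← Polynomial.map_map, map_heckePolynomial]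
    set q : ℕ := ((primesEquiv w : Nat.Primes) : ℕ) with hq
    have hqp : q.Prime := (primesEquiv w).2
    have ha : (qExpansion 1 ⇑g₀).coeff q = a q := hcoeff q hqp hwM
    have hcop : IsCoprime (q : ℤ) (M : ℤ) :=
      Nat.isCoprime_iff_coprime.mpr ((Nat.Prime.coprime_iff_not_dvd hqp).mpr hwM)
    have hχq : χ (q : ZMod M) = nebentypus g₀ (q : ZMod M₀) := by
      have := DirichletCharacter.changeLevel_eq_cast_of_dvd' (nebentypus g₀) hM₀ hcop
      rw [hχ₀] at this
      simpa using this
    simp only [Polynomial.map_add, Polynomial.map_sub, Polynomial.map_mul, Polynomial.map_pow,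
      Polynomial.map_X, Polynomial.map_C, RingHom.coe_coe, ha, hχq]
  -- Step 4: hence `ρ` has `κ`(Hecke polynomial of `g₀`) at all but finitely many places
  have hc' : ∀ᶠ w : HeightOneSpectrum (𝓞 ℚ) in Filter.cofinite,
      ρ.IsUnramifiedAt w ∧
        ρ.HasFrobCharpolyAt w ((heckePolynomial g₀ (primesEquiv w : Nat.Primes)).map κ) := by
    filter_upwards [hc,
      (DeligneSerre1974.finite_setOf_primesEquiv_dvd (NeZero.ne M)).eventually_cofinite_notMem]
      with w hw hwM
    refine ⟨hw.1, ?_⟩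
    rw [hpoly w hwM]
    exact hw.2
  -- Step 5 (Chebotarev + Brauer–Nesbitt): `r ≅ ρ`, transport
  have hS : {v : HeightOneSpectrum (𝓞 ℚ) |
      ((primesEquiv v : Nat.Primes) : ℕ) ∈ {q : ℕ | q ∣ M₀ * ℓ}}.Finite :=
    DeligneSerre1974.finite_setOf_primesEquiv_dvd (mul_ne_zero (NeZero.ne M₀) hℓ.ne_zero)
  obtain ⟨hρg₀, ⟨e⟩⟩ :=
    IsGaloisRepOfNewform1.of_hasFrobCharpolyAt_eventually hS hrss hr hρ hc'
  refine ⟨M₀, inferInstance, hM₀, g₀, hg₀, hcoeff, hχ₀, hρg₀, ?_⟩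
  haveI : r.toGaloisRep.toRepresentation.IsIrreducible := hirr
  exact Literature.RepresentationTheory.Semisimple.Representation.isIrreducible_of_equiv e.toRepEquiv

/-- **The same, in the conclusion shape of the tree's classicality facts** (`∃ N f ι_f,
IsNewform1 f ∧ IsGaloisRepOfNewform1 f ι_f {q ∣ N ℓ} ρ`, as in
`XZhang2024_fontaineMazurGL2_tateTwist` / `Pan2022_proModularDeRhamClassical_GL2Q`): a semisimple
`ρ : Γ_ℚ → GL₂(ℚ̄_ℓ)` carrying, at all but finitely many places, the eigenvalue packet of a
non-zero cuspidal eigenform of weight `k ≥ 2` (read through `ι : ℚ̄_ℓ ≃ ℂ`) is the Galois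
representation of a newform of weight `k`, granted `Hida2000_thm326_exists_galoisRep`.
[cite: DiamondShurman2005, Thms. 5.8.2–5.8.3 (PDF pp. 216–219)] [cite: Hida2000, Thm. 3.26 (1), pp. 151–152]
[cite: DeligneSerreASENS1974, Lemme 3.2 (p. 513)] -/
theorem exists_isNewform1_isGaloisRepOfNewform1_of_eigenform'
    (hH : Hida2000_thm326_exists_galoisRep)
    {M : ℕ} [NeZero M] {k : ℤ} (hk : 2 ≤ k) {g : CuspForm (Gamma1 M) k}
    {χ : DirichletCharacter ℂ M} (hgχ : g ∈ nebentypusSubspace M k χ) (hg0 : g ≠ 0) {a : ℕ → ℂ}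
    (hT : ∀ (p : ℕ) (hp : p.Prime), ¬ p ∣ M →
      (haveI : NeZero p := ⟨hp.ne_zero⟩; heckeT (Gamma1 M) k p g) = a p • g)
    {ℓ : ℕ} [Fact ℓ.Prime] (ι : PadicAlgCl ℓ ≃+* ℂ)
    {ρ : FramedGaloisRep ℚ (PadicAlgCl ℓ) 2} (hρ : ρ.toGaloisRep.IsSemisimple)
    (hc : ∀ᶠ w : HeightOneSpectrum (𝓞 ℚ) in Filter.cofinite,
      ρ.IsUnramifiedAt w ∧
        ρ.HasFrobCharpolyAt w
          (X ^ 2 - C (ι.symm (a ((primesEquiv w : Nat.Primes) : ℕ))) * X +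
            C (ι.symm (χ ((primesEquiv w : Nat.Primes) : ℕ) *
              (((primesEquiv w : Nat.Primes) : ℕ) : ℂ) ^ (k - 1))))) :
    ∃ (N : ℕ) (_ : NeZero N) (f : CuspForm (Gamma1 N) k)
      (ιf : coeffCharField f →+* PadicAlgCl ℓ),
      IsNewform1 f ∧ IsGaloisRepOfNewform1 f ιf {q | q ∣ N * ℓ} ρ := by
  obtain ⟨M₀, _, -, g₀, hg₀, -, -, hρ, -⟩ :=
    exists_isNewform1_isGaloisRepOfNewform1_of_eigenform hH hk hgχ hg0 hT ι hρ hc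
  exact ⟨M₀, inferInstance, g₀, _, hg₀, hρ⟩

end Eigenform

end Literature.NumberTheory.EllipticCurves.ModularForms
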